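import Literature.NumberTheory.Transcendental.CurvePeriodsTransportProofs
import Literature.NumberTheory.Transcendental.CurvePeriodsGmLoopsProofs
import HarnessLib

/-!
# `BetaLinearSector` (stmt-KontsevichZagierPeriods-3897), line `fermat-sector-transport` — stub
# `stub_swapRel` (SW: the swap symmetry of the affine Fermat curve)

On the affine Fermat curve `F_N = {x^N + y^N = 1} ⊂ ℂ²` the swap `f(x, y) = (y, x)` is a polynomial
map over `ℚ̄` with `f(F_N) ⊆ F_N`, and Rohrlich's polynomial 1-forms
`ω_{i,j} = x^{i−1} y^{j−1} (y dx − x dy) = x^{i−1} y^j dx − x^i y^{j−1} dy` satisfy the polynomial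
identity `f^* ω_{j,i} = −ω_{i,j}` (chain rule, `formPullback`).  Hence for every `C¹` path `δ` on
`F_N` with algebraic end points and every path `δ′` with `δ′ = f ∘ δ` on `[0,1]`, the functoriality
relation (R4) `(F_N, f^*ω_{j,i}, δ) − (F_N, ω_{j,i}, δ′)` and the homogeneity relation (R1b)
`(F_N, f^*ω_{j,i}, δ) − (−1)·(F_N, ω_{i,j}, δ)` are elementary relations among period symbols
(Huber–Wüstholz 2022, §13.1 (A), (B)), and their difference is
`(F_N, ω_{i,j}, δ) + (F_N, ω_{j,i}, δ′)`.  So this sum lies in the `ℚ̄`-span of the elementary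
relations; on periods: `∫_δ ω_{i,j} = −∫_{f∘δ} ω_{j,i}` (for the radial arc `γ_N`, whose reverse is
`f ∘ γ_N`, this is the symmetry `B(i/N, j/N) = B(j/N, i/N)`).

References: B. Gross, *On the periods of abelian integrals and a formula of Chowla and Selberg*
(1978), §1 (with Rohrlich's appendix); A. Huber, G. Wüstholz, *Transcendence and Linear Relations of
1-Periods* (2022), §13.1 (A)–(B), §3.3.1.
-/

noncomputable section

open scoped BigOperators
open MeasureTheory Set MvPolynomial
open Literature.NumberTheory.Transcendental Literature.NumberTheory.Transcendental.CurvePeriods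

namespace Summit.KontsevichZagierPeriods.FermatIsogeny.BetaLinearSector

/-! ## The swap `(x, y) ↦ (y, x)` on the Fermat curve -/

/-- The swap `f = (y, x) : ℂ² → ℂ²` is a polynomial map over `ℚ̄`. [folklore] -/
theorem hasAlgCoeffs_fermatSwap :
    ∀ l, HasAlgCoeffs ((![X 1, X 0] : Fin 2 → MvPolynomial (Fin 2) ℂ) l) := by
  intro l
  fin_cases l
  · simpa using hasAlgCoeffs_X (n := 2) 1
  · simpa using hasAlgCoeffs_X (n := 2) 0

/-- The swap maps the Fermat curve `F_N = {x^N + y^N = 1}` into itself (`y^N + x^N = x^N + y^N`).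
[cite: Gross1978, §1] -/
theorem fermatSwap_mem_points (N : ℕ) :
    ∀ z ∈ (⟨2, 1, ![X 0 ^ N + X 1 ^ N - 1]⟩ : CurveData).points,
      (fun l => eval z ((![X 1, X 0] : Fin 2 → MvPolynomial (Fin 2) ℂ) l)) ∈
        (⟨2, 1, ![X 0 ^ N + X 1 ^ N - 1]⟩ : CurveData).points := by
  intro z hz
  have hz' := (CurveData.mem_points (Z := ⟨2, 1, ![X 0 ^ N + X 1 ^ N - 1]⟩) (z := z)).1 hz
  refine (CurveData.mem_points (Z := ⟨2, 1, ![X 0 ^ N + X 1 ^ N - 1]⟩)).2 ?_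
  simp only [Fin.forall_fin_one, Fin.isValue, Matrix.cons_val_zero, Matrix.cons_val_one, map_sub,
    map_add, map_pow, eval_X, map_one] at hz' ⊢
  linear_combination hz'

/-- The chain rule for the swap: `f^* ω_{j,i} = −ω_{i,j}`, where
`ω_{i,j} = x^{i−1} y^j dx − x^i y^{j−1} dy` and `f = (y, x)`; as an identity of polynomial 1-forms
(`formPullback f ω′ = (Σ_l (ω′_l ∘ f) ∂f_l/∂x_k)_k`). [cite: HuberWustholz2022, §13.1 (B) (p. 120)] -/
theorem formPullback_fermatSwap (i j : ℕ) :
    formPullback (![X 1, X 0] : Fin 2 → MvPolynomial (Fin 2) ℂ)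
        (![X 0 ^ (j - 1) * X 1 ^ i, -(X 0 ^ j * X 1 ^ (i - 1))] :
          Fin 2 → MvPolynomial (Fin 2) ℂ) =
      (-1 : ℂ) • (![X 0 ^ (i - 1) * X 1 ^ j, -(X 0 ^ i * X 1 ^ (j - 1))] :
        Fin 2 → MvPolynomial (Fin 2) ℂ) := by
  funext l
  fin_cases l
  · simp [formPullback, Fin.sum_univ_two, pderiv_X]
    ring
  · simp [formPullback, Fin.sum_univ_two, pderiv_X]
    ring

/-- SECTOR STUB SW (the SWAP RELATION): for the swap automorphism `f(x, y) = (y, x)` of the Fermat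
curve `F_N` and any `C¹` path `δ` on `F_N` with algebraic end points, if `δ′ = f ∘ δ` on `[0,1]` then
`(F_N, ω_{i,j}, δ) + (F_N, ω_{j,i}, δ′)` lies in the `ℚ̄`-span of the elementary relations: it is
the difference of the homogeneity relation (R1b) `(F_N, f^*ω_{j,i}, δ) − (−1)·(F_N, ω_{i,j}, δ)`
(`f^*ω_{j,i} = −ω_{i,j}`, `formPullback_fermatSwap`) and the functoriality relation (R4)
`(F_N, f^*ω_{j,i}, δ) − (F_N, ω_{j,i}, f ∘ δ)`. [cite: HuberWustholz2022, §13.1 (B) (p. 120)] -/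
theorem stub_swapRel : ∀ (N i j : ℕ), 1 ≤ i → 1 ≤ j →
    ∀ (hZ : (⟨2, 1, ![X 0 ^ N + X 1 ^ N - 1]⟩ : CurveData).IsSmoothAffineCurve)
      (hω : ∀ l, HasAlgCoeffs ((![X 0 ^ (i - 1) * X 1 ^ j, -(X 0 ^ i * X 1 ^ (j - 1))] :
        Fin 2 → MvPolynomial (Fin 2) ℂ) l))
      (hω' : ∀ l, HasAlgCoeffs ((![X 0 ^ (j - 1) * X 1 ^ i, -(X 0 ^ j * X 1 ^ (i - 1))] :
        Fin 2 → MvPolynomial (Fin 2) ℂ) l))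
      (δ δ' : CurvePath (⟨2, 1, ![X 0 ^ N + X 1 ^ N - 1]⟩ : CurveData)),
    (∀ t ∈ Set.Icc (0:ℝ) 1, δ'.toFun t = ![δ.toFun t 1, δ.toFun t 0]) →
    ∃ (k : ℕ) (ρ : Fin k → (PeriodSymbol →₀ ℂ)) (a : Fin k → ℂ),
      (∀ l, IsElementaryRelation (ρ l)) ∧ (∀ l, IsAlgebraic ℚ (a l)) ∧
      (Finsupp.single (⟨(⟨2, 1, ![X 0 ^ N + X 1 ^ N - 1]⟩ : CurveData), hZ,
            (![X 0 ^ (i - 1) * X 1 ^ j, -(X 0 ^ i * X 1 ^ (j - 1))] : Fin 2 → MvPolynomial (Fin 2) ℂ), hω, δ⟩ :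
            PeriodSymbol) (1 : ℂ) +
          Finsupp.single (⟨(⟨2, 1, ![X 0 ^ N + X 1 ^ N - 1]⟩ : CurveData), hZ,
            (![X 0 ^ (j - 1) * X 1 ^ i, -(X 0 ^ j * X 1 ^ (i - 1))] : Fin 2 → MvPolynomial (Fin 2) ℂ), hω', δ'⟩ :
            PeriodSymbol) (1 : ℂ)) =
        ∑ l, a l • ρ l := by
  intro N i j _ _ hZ hω hω' δ δ' hδ'
  -- the pulled-back form `f^* ω_{j,i}` (a local name keeps the two relations below on the nose)
  obtain ⟨ωpb, hωpb⟩ : ∃ ωpb : Fin 2 → MvPolynomial (Fin 2) ℂ,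
      ωpb = formPullback (![X 1, X 0] : Fin 2 → MvPolynomial (Fin 2) ℂ)
        (![X 0 ^ (j - 1) * X 1 ^ i, -(X 0 ^ j * X 1 ^ (i - 1))] :
          Fin 2 → MvPolynomial (Fin 2) ℂ) := ⟨_, rfl⟩
  have hpb : ∀ l, HasAlgCoeffs (ωpb l) := by
    rw [hωpb]
    exact HasAlgCoeffs.formPullback hasAlgCoeffs_fermatSwap hω'
  have hsmul : ωpb = (-1 : ℂ) • (![X 0 ^ (i - 1) * X 1 ^ j, -(X 0 ^ i * X 1 ^ (j - 1))] :
      Fin 2 → MvPolynomial (Fin 2) ℂ) := hωpb.trans (formPullback_fermatSwap i j)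
  -- (R4) functoriality along the swap: `(F_N, f^*ω_{j,i}, δ) − (F_N, ω_{j,i}, δ′)`
  have r4 := IsElementaryRelation.pushforward (⟨2, 1, ![X 0 ^ N + X 1 ^ N - 1]⟩ : CurveData)
    (⟨2, 1, ![X 0 ^ N + X 1 ^ N - 1]⟩ : CurveData) hZ hZ
    (![X 1, X 0] : Fin 2 → MvPolynomial (Fin 2) ℂ) hasAlgCoeffs_fermatSwap (fermatSwap_mem_points N)
    (![X 0 ^ (j - 1) * X 1 ^ i, -(X 0 ^ j * X 1 ^ (i - 1))] : Fin 2 → MvPolynomial (Fin 2) ℂ) hω'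
    ωpb hpb hωpb δ δ' (fun t ht => by
      rw [hδ' t ht]
      funext l
      fin_cases l
      · simp
      · simp)
  -- (R1b) homogeneity: `(F_N, f^*ω_{j,i}, δ) − (−1) · (F_N, ω_{i,j}, δ)`
  have r1 := IsElementaryRelation.smul (⟨2, 1, ![X 0 ^ N + X 1 ^ N - 1]⟩ : CurveData) hZ δ (-1)
    isAlgebraic_one.neg
    (![X 0 ^ (i - 1) * X 1 ^ j, -(X 0 ^ i * X 1 ^ (j - 1))] : Fin 2 → MvPolynomial (Fin 2) ℂ)
    ωpb hω hpb hsmul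
  obtain ⟨k, ρ, a, hρ, ha, he⟩ := span_sub (span_of_rel r1) (span_of_rel r4)
  refine ⟨k, ρ, a, hρ, ha, ?_⟩
  rw [← he]
  simp only [neg_smul, one_smul, sub_neg_eq_add]
  abel

end Summit.KontsevichZagierPeriods.FermatIsogeny.BetaLinearSector

end
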